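import Literature.AlgebraicGeometry.AbelianSchemes.AbelianSchemeQuotientDualPairUniversalOfLevel
import Literature.AlgebraicGeometry.AbelianSchemes.RigidifiedTrivialFpqcDescent
import HarnessLib

/-!
# The universal property of the dual pair of `A/K` from the level data, with the descent input (u6b) DISCHARGED
# (HECKE-LINK H2, D6 junction ∘ (u6b))

Layer `Literature/AlgebraicGeometry/AbelianSchemes`, namespace `Literature.AlgebraicGeometry.AbelianSchemes.AbelianSchemeOver`.
THEOREMS ONLY; no definition, no named fact, no instance, no notation, no `sorry`.

★ `AbelianSchemeQuotientDualPairUniversalOfLevel.universal_poincareQuotRigid_of_level` (B-p08 (g10)) proves the `h4`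
binder of ★ `dualPairOfQuotientRigidified` — the universal property of `(Â/K′, 𝒫_B^{rig})` for `B := A/K` ([MumfordAV1970]
§15 Thm. 1, [MilneAV2008] I §8–§9) — modulo two inputs: `hStab` (the stabiliser/uniqueness input (K)) and `hdesc` («two
rigidified line bundles on `B_T` isomorphic after an affine faithfully flat base change are isomorphic», the descent step
of [MumfordAV1970] §13 p. 125).  Over a locally Noetherian `S` the second input is a THEOREM — ★
`RigidifiedTrivialFpqcDescent`'s `RigidifiedLineBundle.nonempty_iso_of_pullback_prodMap_of_isLocallyNoetherian`
(B-p13 (g17), (u6b)) — and this file plugs it in: **`universal_poincareQuotRigid_of_level_of_desc`** is the statement of ★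
`universal_poincareQuotRigid_of_level` with the `hdesc` binder removed (everything else binder for binder verbatim).
Cell `hodgecm-mathlib`, HECKE-LINK socket (B), D6 (composer input (S2b); B-plan1 (g15) 2026-08-30 01:25Z (3)).
HC_CM is proved only modulo the 7 printed citations until rung 0 closes; nothing here is about HC.

## References
* [MumfordAV1970] D. Mumford, *Abelian Varieties* (1970), §13 (p. 125), §15 Thm. 1 (p. 143).
* [MilneAV2008] J. S. Milne, *Abelian Varieties* (2008), I §8 (pp. 36–37), I §9 Thm. 9.1 (p. 42).
-/

noncomputable section

-- `(A.baseChange f).X = (Over.pullback f).obj A.X` / `(A.X ⊗ B.X).left = A.prodLeft B` hold by `rfl` only.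
set_option backward.isDefEq.respectTransparency false

universe u

open CategoryTheory CategoryTheory.Limits AlgebraicGeometry MonoidalCategory CartesianMonoidalCategory
open scoped MonObj

namespace Literature.AlgebraicGeometry.AbelianSchemes

namespace AbelianSchemeOver

open Literature.AlgebraicGeometry.RelativeSpec Literature.AlgebraicGeometry.AbelianVarieties
  Literature.AlgebraicGeometry.Motives Literature.AlgebraicGeometry.Modules

variable {S : Scheme.{u}} (A : AbelianSchemeOver S)
  {Y : Scheme.{u}} (u : S ⟶ Y) (K : Subgroup A.Sections) [IsCommMonObj A.X] {n : ℕ}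
  (hK : ∀ σ : K, (σ : A.Sections) ^ n = 1)
  [Finite K] [Y.IsSeparated] [IsSeparated (A.X.hom ≫ u)] [S.IsSeparated]
  (hcov : ∀ x : A.left, ∃ O : (A.translationActionOver u K).StableAffineOpens, x ∈ O.1)
  [LocallyOfFiniteType (A.X.hom ≫ u)] [IsLocallyNoetherian Y]
  (hG : ∃ _ : GrpObj (A.quotientOver u K), IsMonHom (A.quotientMk u K hcov))
  (hsm : Smooth (A.quotientOver u K).hom) (hgc : GeometricallyConnected (A.quotientOver u K).hom)
  (D : A.DualPair) [IsAffine Y]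
  (hfree : ∀ (Ω : Type u) [Field Ω] [IsAlgClosed Ω] (x : Spec (.of Ω) ⟶ A.left) (σ : K), σ ≠ 1 →
    x ≫ (A.translation (σ : A.Sections)).left ≠ x)

variable
  -- the dual side: a finite subgroup `K′ ≤ Â(S)` with the file-(i) hypotheses for `(Â, K′)`
  (K' : Subgroup D.hat.Sections) [Finite K'] [IsSeparated (D.hat.X.hom ≫ u)]
  (hcov' : ∀ x : D.hat.left, ∃ O : (D.hat.translationActionOver u K').StableAffineOpens, x ∈ O.1)
  [LocallyOfFiniteType (D.hat.X.hom ≫ u)]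
  (hG' : ∃ _ : GrpObj (D.hat.quotientOver u K'), IsMonHom (D.hat.quotientMk u K' hcov'))
  (hsm' : Smooth (D.hat.quotientOver u K').hom) (hgc' : GeometricallyConnected (D.hat.quotientOver u K').hom)
  (hfree' : ∀ (Ω : Type u) [Field Ω] [IsAlgClosed Ω] (x : Spec (.of Ω) ⟶ D.hat.left) (σ : K'), σ ≠ 1 →
    x ≫ (D.hat.translation (σ : D.hat.Sections)).left ≠ x)
  -- D3b's output: a `K′`-equivariant structure on `𝒩₁` for the D3a action
  (Φ : (prodTranslationActionOver (A.quotientBy u K hcov hG hsm hgc) D.hat u K' hcov').EquivariantStructure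
    (A.poincarePullback u K hK hcov hG hsm hgc D hfree))

include hfree' in
/-- **The universal property of `(Â/K′, 𝒫_B^{rig})` from the level data, `hdesc` discharged by (u6b)** (over a reduced,
locally Noetherian `S`): ★ `universal_poincareQuotRigid_of_level` with
`hdesc := RigidifiedLineBundle.nonempty_iso_of_pullback_prodMap_of_isLocallyNoetherian` (★ `RigidifiedTrivialFpqcDescent`).
The remaining raw input `hStab` is (K) (★ `PoincarePullbackStabilizerOfLevel`).
[cite: MumfordAV1970, §13 (p. 125), §15 Thm. 1 (p. 143)] [cite: MilneAV2008, I §8 (pp. 36–37), I §9 Thm. 9.1 (p. 42)] -/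
theorem universal_poincareQuotRigid_of_level_of_desc [IsReduced S] [IsLocallyNoetherian S] [IsCommMonObj D.hat.X] {g : ℕ}
    (φ : LevelStructure g n D.hat) (hn : ∀ s : S, (n : S.residueField s) ≠ 0) (hcard : Nat.card K * Nat.card K' = n ^ (2 * g))
    (hD : Nonempty ((Scheme.Modules.pullback (DualPair.unitHatSlice D)).obj D.P ≅ SheafOfModules.unit _))
    (hStab : ∀ {T : Scheme.{u}} (f : T ⟶ S) (a a' : T ⟶ D.hat.X.left) (ha : a ≫ D.hat.X.hom = f)
      (ha' : a' ≫ D.hat.X.hom = f),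
      Nonempty ((Scheme.Modules.pullback ((A.quotientBy u K hcov hG hsm hgc).baseChangeToProd D.hat f a ha)).obj
          (A.poincarePullbackBundle u K hK hcov hG hsm hgc D hfree).L ≅
        (Scheme.Modules.pullback ((A.quotientBy u K hcov hG hsm hgc).baseChangeToProd D.hat f a' ha')).obj
          (A.poincarePullbackBundle u K hK hcov hG hsm hgc D hfree).L) →
      a ≫ (D.hat.quotientMk u K' hcov').left = a' ≫ (D.hat.quotientMk u K' hcov').left) :
    ∀ {T : Scheme.{u}} (f : T ⟶ S) (ℒ : (A.quotientBy u K hcov hG hsm hgc).RigidifiedLineBundle f),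
      ℒ.FibrewisePicZero →
      ∃! g : {g : T ⟶ (D.hat.quotientBy u K' hcov' hG' hsm' hgc').X.left //
          g ≫ (D.hat.quotientBy u K' hcov' hG' hsm' hgc').X.hom = f},
        Nonempty ((Scheme.Modules.pullback ((A.quotientBy u K hcov hG hsm hgc).baseChangeToProd
          (D.hat.quotientBy u K' hcov' hG' hsm' hgc') f g.1 g.2)).obj
            (A.poincareQuotRigid u K hK hcov hG hsm hgc D hfree K' hcov' hG' hsm' hgc' Φ) ≅ ℒ.L) :=
  A.universal_poincareQuotRigid_of_level u K hK hcov hG hsm hgc D hfree K' hcov' hG' hsm' hgc' hfree' Φ φ hn hcard hD hStab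
    fun f c _ _ _ M₁ M₂ h => RigidifiedLineBundle.nonempty_iso_of_pullback_prodMap_of_isLocallyNoetherian f c M₁ M₂ h

end AbelianSchemeOver

end Literature.AlgebraicGeometry.AbelianSchemes

end
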